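/-
Copyright: cell pub-balaban-gaps (YM BLITZ Y1, track G1), seat g1-p2 GEN 8 (unit `pub-balaban-gaps-g1-p2`).  Row (D4) NODE O,
JUNCTION J-3 (multi-level), FAITHFULNESS AT THE OPERATOR LEVEL: on [4]'s nested family of domains of the torus the generic flat
Laplacian of `D4WalkBlockShiftStep` IS `η⁻²·(−Δ^{per}) ⊗ 1_F` (the lineage's periodic Laplacian `perLapT`), hence the kernel
expanded in `D4WalkBlockCovariantShiftMultiLevel` ∕ `…CovariantTransportMultiLevel` — `(W ⊗ 1)(1 − V(W ⊗ 1))⁻¹`, `W = η²Δ′_a^{−1}` —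
IS `(Δ_W + η⁻²·(Q′*aQ′-part of Δ′_a) ⊗ 1 − V_extra)⁻¹`: the covariant Laplacian (3.50) with transport defects PLUS the FLAT multi-level
averaging form of (2.13)–(2.14), inverted ([B9] (3.62)∕(3.64) resummation).  HONEST FRAMING: matrix algebra over the lineage's
objects; invertibility of `1 − V(W ⊗ 1)` is a HYPOTHESIS here (63's ℓ^∞-Neumann lemma discharges it from the letters on the one-scale
carrier); nothing of Bałaban's constructed; (D4) NOT discharged (instance 0∕1); NOT BetaPertH, NOT continuum, NOT Clay.
-/
import Summits.QuantumFields.BalabanUV.Gaps.D4WalkBlockCovariantShiftMultiLevel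

/-!
# `Gaps.D4WalkBlockCovariantKernelMultiLevel` — what the multi-level covariant expansion expands: `flatLap = η⁻²(−Δ^{per}) ⊗ 1`
# and `(W ⊗ 1)(1 − V(W ⊗ 1))⁻¹ = (Δ_W + η⁻²(Δ′_a − (−Δ^{per})) ⊗ 1 − V_av)⁻¹` (cell pub-balaban-gaps, seat g1-p2 gen 8)

HONEST DEPENDENCY (cell pub-balaban, verbatim): continuum YM on T⁴ ⇐ BetaPertH ∧ nine spine estimates (0/9 proved);
BetaPertH ⇐ (D1) ∧ (D4) ∧ CAP+tail.

* §1 `Sfw_tshift_eq` ∕ `Sbw_tshift_eq` (the generic shifts on `boxDom N₀ × F` are `shiftMat (±e_μ) ⊗ 1_F`), **`flatLap_tshift_eq`**: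
  `flatLap = η⁻²·(perLapT.map ofReal) ⊗ 1_F` (`B6MultiLevelTorusOperator.perLapT = Σ_μ(2 − S_{e_μ} − S_{−e_μ})`);
* §2 **`covariant_kernel_eq_multiLevel`**: with `W = η²·(gmlT.map ofReal)` (`gmlT = Δ′_a^{−1}`, weights positive at levels `≥ 1`),
  `Qp := Δ′_a − (−Δ^{per})` (the averaging part, `mlOpT_eq`), the generic covariant Laplacian `covLap` with defects `W^±` and any
  extra perturbation `Vx` (the averaging slot): IF `1 − (V_W + Vx)(W ⊗ 1)` is invertible THEN
  `(W ⊗ 1)(1 − (V_W(u) + Vx)(W ⊗ 1))⁻¹ = (covLap(u) + η⁻²·(Qp.map ofReal) ⊗ 1 − Vx)⁻¹` — by `D4WalkBlockShiftStep.flatLap_sub_covLap`, §1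
  and `D4WalkBlockDerivative.perturb_kernel_eq_inv`.
WHAT IT IS NOT.  Invertibility from the letters (63's `isUnit_one_sub_of_blockLetters`, one-scale carrier, staged); Bałaban's COVARIANT
averaging `Q′(U)` (here the averaging part stays flat — 59b's reading «Laplacian in the background, averaging flat»); (D4) instance 0∕1.

References: T. Bałaban, Comm. Math. Phys. **99** (1985) 389–434 [B9], (3.50) p. 400, (3.60)–(3.64) p. 402; Comm. Math. Phys. **96**
(1984) [4], (2.13)–(2.14) p. 225, Prop. 2.2 p. 234.
-/

noncomputable section

namespace Summit.QuantumFields.BalabanUV.Gaps.D4WalkBlockCovariantKernelMultiLevel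

open Finset Metric
open scoped Matrix
open Literature.MathematicalPhysics.QuantumFieldTheory.Balaban1983to89
open Literature.MathematicalPhysics.QuantumFieldTheory.Balaban1983to89.B4Reflection242 (boxDom)
open Literature.MathematicalPhysics.QuantumFieldTheory.Balaban1983to89.B6MultiLevelBoxOperator (N0)
open Literature.MathematicalPhysics.QuantumFieldTheory.Balaban1983to89.B6MultiLevelTorusOperator (TDomains gmlT mlOpT perLapT tshift
  tshift_symm_apply shiftMat unitVec one_le_N0)
open Literature.MathematicalPhysics.QuantumFieldTheory.Balaban1983to89.B6Prop22MultiLevelTorus (gmlT_mul_mlOpT_pos)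
open Summit.QuantumFields.BalabanUV.Gaps.D4WalkBlockDerivative (perturb_kernel_eq_inv)
open Summit.QuantumFields.BalabanUV.Gaps.D4WalkBlockFlatLetters (map_ofReal_mul)
open Summit.QuantumFields.BalabanUV.Gaps.D4WalkBlockShiftAlgebra (relab Sfw Sbw covShift)
open Summit.QuantumFields.BalabanUV.Gaps.D4WalkBlockShiftStep (covLap flatLap flatLap_sub_covLap)
open Summit.QuantumFields.BalabanUV.Gaps.D4WalkBlockCovariantShiftMultiLevel (relab_tshift_eq)

variable {d : ℕ} {N : Fin (d + 1) → ℕ} {F : Type} [Fintype F] [DecidableEq F]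

/-! ## §1. The generic flat Laplacian on the torus box is `η⁻²(−Δ^{per}) ⊗ 1_F` -/

omit [Fintype F] in
/-- the generic forward shift is `shiftMat e_μ ⊗ 1_F`. -/
theorem Sfw_tshift_eq (μ : Fin (d + 1)) :
    Sfw ↥(boxDom N) F (fun ν => tshift N (unitVec ν)) μ = Matrix.blockDiagonal fun _ : F => (shiftMat N (unitVec μ)).map ((↑) : ℝ → ℂ) :=
  relab_tshift_eq _

omit [Fintype F] in
/-- the generic backward shift is `shiftMat (−e_μ) ⊗ 1_F`. -/
theorem Sbw_tshift_eq (μ : Fin (d + 1)) :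
    Sbw ↥(boxDom N) F (fun ν => tshift N (unitVec ν)) μ =
      Matrix.blockDiagonal fun _ : F => (shiftMat N (-unitVec μ)).map ((↑) : ℝ → ℂ) := by
  unfold Sbw
  have e : (((tshift N (unitVec μ)).symm : ↥(boxDom N) ≃ ↥(boxDom N)) : ↥(boxDom N) → ↥(boxDom N)) = tshift N (-unitVec μ) := by
    funext x; exact tshift_symm_apply N (unitVec μ) x
  rw [e]
  exact relab_tshift_eq _

omit [Fintype F] in
/-- **`flatLap = η⁻²·(−Δ^{per}) ⊗ 1_F`** on `boxDom N × F` with the unit translations: the generic flat Laplacian of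
`D4WalkBlockShiftStep` is the lineage's periodic Laplacian `perLapT`, complexified, fibred, in print's units.
[cite: Balaban1984PropagatorsII, (2.13) p.225; Balaban1985BackgroundPropagators, (3.23) p.394] -/
theorem flatLap_tshift_eq (η : ℝ) :
    flatLap ↥(boxDom N) F (fun ν => tshift N (unitVec ν)) η =
      (((η : ℂ)⁻¹) ^ 2) • Matrix.blockDiagonal fun _ : F => (perLapT N).map ((↑) : ℝ → ℂ) := by
  unfold flatLap
  congr 1
  simp_rw [Sfw_tshift_eq, Sbw_tshift_eq]
  -- each summand is fibre-diagonal
  have hterm : ∀ μ : Fin (d + 1), (2 : ℂ) • (1 : Matrix (↥(boxDom N) × F) (↥(boxDom N) × F) ℂ) -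
      Matrix.blockDiagonal (fun _ : F => (shiftMat N (unitVec μ)).map ((↑) : ℝ → ℂ)) -
      Matrix.blockDiagonal (fun _ : F => (shiftMat N (-unitVec μ)).map ((↑) : ℝ → ℂ)) =
      Matrix.blockDiagonal (fun _ : F => (2 : ℂ) • (1 : Matrix ↥(boxDom N) ↥(boxDom N) ℂ) -
        (shiftMat N (unitVec μ)).map ((↑) : ℝ → ℂ) - (shiftMat N (-unitVec μ)).map ((↑) : ℝ → ℂ)) := by
    intro μ
    rw [show (fun _ : F => (2 : ℂ) • (1 : Matrix ↥(boxDom N) ↥(boxDom N) ℂ) - (shiftMat N (unitVec μ)).map ((↑) : ℝ → ℂ) -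
        (shiftMat N (-unitVec μ)).map ((↑) : ℝ → ℂ)) = (2 : ℂ) • (1 : F → Matrix ↥(boxDom N) ↥(boxDom N) ℂ) -
        (fun _ : F => (shiftMat N (unitVec μ)).map ((↑) : ℝ → ℂ)) - (fun _ : F => (shiftMat N (-unitVec μ)).map ((↑) : ℝ → ℂ))
        from by funext a; simp only [Pi.sub_apply, Pi.smul_apply, Pi.one_apply],
      Matrix.blockDiagonal_sub, Matrix.blockDiagonal_sub, Matrix.blockDiagonal_smul, Matrix.blockDiagonal_one]
  simp_rw [hterm]
  -- the sum of fibre-diagonal matrices is the fibre-diagonal of the sum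
  rw [show (∑ μ : Fin (d + 1), Matrix.blockDiagonal (fun _ : F => (2 : ℂ) • (1 : Matrix ↥(boxDom N) ↥(boxDom N) ℂ) -
        (shiftMat N (unitVec μ)).map ((↑) : ℝ → ℂ) - (shiftMat N (-unitVec μ)).map ((↑) : ℝ → ℂ))) =
      Matrix.blockDiagonal (∑ μ : Fin (d + 1), fun _ : F => (2 : ℂ) • (1 : Matrix ↥(boxDom N) ↥(boxDom N) ℂ) -
        (shiftMat N (unitVec μ)).map ((↑) : ℝ → ℂ) - (shiftMat N (-unitVec μ)).map ((↑) : ℝ → ℂ))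
      from by
        simpa only [Matrix.blockDiagonalAddMonoidHom_apply] using
          (map_sum (Matrix.blockDiagonalAddMonoidHom ↥(boxDom N) ↥(boxDom N) F ℂ)
            (fun μ : Fin (d + 1) => fun _ : F => (2 : ℂ) • (1 : Matrix ↥(boxDom N) ↥(boxDom N) ℂ) -
              (shiftMat N (unitVec μ)).map ((↑) : ℝ → ℂ) - (shiftMat N (-unitVec μ)).map ((↑) : ℝ → ℂ)) Finset.univ).symm]
  congr 1
  funext a
  rw [Finset.sum_apply]
  -- entrywise: the complexified periodic Laplacian
  ext x y
  simp only [perLapT, Matrix.map_apply, Matrix.sum_apply, Matrix.sub_apply, Matrix.smul_apply, Matrix.one_apply, smul_eq_mul]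
  push_cast
  refine Finset.sum_congr rfl fun μ _ => ?_
  split_ifs <;> simp

/-! ## §2. The kernel identity: what the multi-level covariant expansion expands -/

section Kernel

variable {ℓ Mh k R : ℕ} {P : Fin (d + 1) → ℕ}
variable {E : Type*} [NormedAddCommGroup E] [NormedSpace ℂ E]

/-- `(M ⊗ 1_F)(M′ ⊗ 1_F) = (MM′) ⊗ 1_F` for complexified real matrices with scalars. -/
theorem blockDiagonal_smul_map_mul (c c' : ℂ) (M M' : Matrix ↥(boxDom N) ↥(boxDom N) ℝ) :
    Matrix.blockDiagonal (fun _ : F => c • M.map ((↑) : ℝ → ℂ)) * Matrix.blockDiagonal (fun _ : F => c' • M'.map ((↑) : ℝ → ℂ)) =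
      Matrix.blockDiagonal (fun _ : F => (c * c') • (M * M').map ((↑) : ℝ → ℂ)) := by
  rw [← Matrix.blockDiagonal_mul]
  congr 1
  funext a
  rw [Matrix.smul_mul, Matrix.mul_smul, smul_smul, map_ofReal_mul]

omit [NormedAddCommGroup E] [NormedSpace ℂ E] in
/-- **THE KERNEL IDENTITY (multi-level, [B9] (3.62)∕(3.64)).**  Let `D` be a nested family on the torus (`M_h, P ≥ 1`), `a` weights
positive at levels `≥ 1`, `G′ = gmlT = Δ′_a^{−1}`, `W = η²(G′.map ofReal)` with `η = L^{−k}`, `V_W` the covariant shift of the unit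
translations with defects `W^±`, `Vx` any further perturbation (the averaging slot).  IF `1 − (V_W(u) + Vx)(W ⊗ 1)` is invertible THEN
`(W ⊗ 1)(1 − (V_W(u) + Vx)(W ⊗ 1))⁻¹ = (Δ_W(u) + η⁻²·((Δ′_a − (−Δ^{per})).map ofReal) ⊗ 1 − Vx)⁻¹` — the covariant Laplacian (3.50) with
defects plus the FLAT multi-level averaging form `Σ_j a_jL^{−2j}Q′_j*1_{Λ_j}Q′_j` of (2.13)–(2.14) (`mlOpT − perLapT`), minus the slot, inverted.
[cite: Balaban1985BackgroundPropagators, (3.60)–(3.64) p.402, (3.50) p.400; Balaban1984PropagatorsII, (2.13)–(2.14) p.225] -/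
theorem covariant_kernel_eq_multiLevel (hMh : 1 ≤ Mh) (hP : ∀ μ, 1 ≤ P μ) (D : TDomains d ℓ Mh k P R) {a : ℕ → ℝ}
    (ha : ∀ j, 1 ≤ j → 0 < a j) (Wp Wm : Fin (d + 1) → E → ↥(boxDom (N0 ℓ Mh k P)) → Matrix F F ℂ)
    (Vx : Matrix (↥(boxDom (N0 ℓ Mh k P)) × F) (↥(boxDom (N0 ℓ Mh k P)) × F) ℂ) (u : E)
    (hunit : IsUnit (1 - (covShift ↥(boxDom (N0 ℓ Mh k P)) F (fun ν => tshift (N0 ℓ Mh k P) (unitVec ν)) ((((ℓ : ℝ) + 1) ^ k)⁻¹)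
        Wp Wm u + Vx) * Matrix.blockDiagonal (fun _ : F =>
          ((((ℓ : ℂ) + 1) ^ (2 * k))⁻¹ : ℂ) • (gmlT (N0 ℓ Mh k P) ℓ k D.lev a).map ((↑) : ℝ → ℂ))).det) :
    Matrix.blockDiagonal (fun _ : F => ((((ℓ : ℂ) + 1) ^ (2 * k))⁻¹ : ℂ) • (gmlT (N0 ℓ Mh k P) ℓ k D.lev a).map ((↑) : ℝ → ℂ)) *
        (1 - (covShift ↥(boxDom (N0 ℓ Mh k P)) F (fun ν => tshift (N0 ℓ Mh k P) (unitVec ν)) ((((ℓ : ℝ) + 1) ^ k)⁻¹) Wp Wm u + Vx) *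
          Matrix.blockDiagonal (fun _ : F =>
            ((((ℓ : ℂ) + 1) ^ (2 * k))⁻¹ : ℂ) • (gmlT (N0 ℓ Mh k P) ℓ k D.lev a).map ((↑) : ℝ → ℂ)))⁻¹ =
      (covLap ↥(boxDom (N0 ℓ Mh k P)) F (fun ν => tshift (N0 ℓ Mh k P) (unitVec ν)) ((((ℓ : ℝ) + 1) ^ k)⁻¹) Wp Wm u +
        Matrix.blockDiagonal (fun _ : F => (((ℓ : ℂ) + 1) ^ (2 * k) : ℂ) •
          (mlOpT (N0 ℓ Mh k P) ℓ k D.lev a - perLapT (N0 ℓ Mh k P)).map ((↑) : ℝ → ℂ)) - Vx)⁻¹ := by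
  have hL0 : ((ℓ : ℂ) + 1) ≠ 0 := by
    have : (0 : ℝ) < (ℓ : ℝ) + 1 := by positivity
    exact_mod_cast this.ne'
  have hc : (((ℓ : ℂ) + 1) ^ (2 * k) : ℂ) ≠ 0 := pow_ne_zero _ hL0
  -- `Δ := η⁻²(Δ′_a.map ofReal) ⊗ 1` inverts `W ⊗ 1`
  have hGE : mlOpT (N0 ℓ Mh k P) ℓ k D.lev a * gmlT (N0 ℓ Mh k P) ℓ k D.lev a = 1 :=
    mul_eq_one_comm.1 (gmlT_mul_mlOpT_pos (one_le_N0 hMh hP) D.one_le_lev D.lev_le ha)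
  have hΔW : Matrix.blockDiagonal (fun _ : F => (((ℓ : ℂ) + 1) ^ (2 * k) : ℂ) • (mlOpT (N0 ℓ Mh k P) ℓ k D.lev a).map ((↑) : ℝ → ℂ)) *
      Matrix.blockDiagonal (fun _ : F => ((((ℓ : ℂ) + 1) ^ (2 * k))⁻¹ : ℂ) • (gmlT (N0 ℓ Mh k P) ℓ k D.lev a).map ((↑) : ℝ → ℂ)) = 1 := by
    rw [blockDiagonal_smul_map_mul, mul_inv_cancel₀ hc, hGE, Matrix.map_one _ Complex.ofReal_zero Complex.ofReal_one, one_smul]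
    exact Matrix.blockDiagonal_one
  rw [perturb_kernel_eq_inv _ _ _ hΔW hunit]
  -- `V_W = flatLap − covLap`, `flatLap = η⁻²(−Δ^{per}) ⊗ 1`
  rw [← flatLap_sub_covLap (X := ↥(boxDom (N0 ℓ Mh k P))) (F := F) (sh := fun ν => tshift (N0 ℓ Mh k P) (unitVec ν))
    (Wp := Wp) (Wm := Wm) (by positivity) u, flatLap_tshift_eq]
  have hη : ((((((ℓ : ℝ) + 1) ^ k)⁻¹ : ℝ) : ℂ))⁻¹ ^ 2 = (((ℓ : ℂ) + 1) ^ (2 * k) : ℂ) := by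
    push_cast
    rw [inv_inv, ← pow_mul, mul_comm]
  rw [hη]
  congr 1
  have hsplit : Matrix.blockDiagonal (fun _ : F => (((ℓ : ℂ) + 1) ^ (2 * k) : ℂ) • (mlOpT (N0 ℓ Mh k P) ℓ k D.lev a).map ((↑) : ℝ → ℂ))
      = (((ℓ : ℂ) + 1) ^ (2 * k) : ℂ) • Matrix.blockDiagonal (fun _ : F => (perLapT (N0 ℓ Mh k P)).map ((↑) : ℝ → ℂ)) +
        Matrix.blockDiagonal (fun _ : F => (((ℓ : ℂ) + 1) ^ (2 * k) : ℂ) •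
          (mlOpT (N0 ℓ Mh k P) ℓ k D.lev a - perLapT (N0 ℓ Mh k P)).map ((↑) : ℝ → ℂ)) := by
    rw [← Matrix.blockDiagonal_smul, ← Matrix.blockDiagonal_add]
    congr 1
    funext x
    simp only [Pi.smul_apply, Pi.add_apply]
    rw [Matrix.map_sub _ (fun p q => Complex.ofReal_sub p q), smul_sub, add_sub_cancel]
  rw [hsplit]
  abel

end Kernel

end Summit.QuantumFields.BalabanUV.Gaps.D4WalkBlockCovariantKernelMultiLevel

end
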